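import Literature.AnabelianGeometry.EtaleTheta.FrobenioidThetaTowerOfBiKummerFamily

/-!
# [EtTh] §5 tower, assembled: the outer `ρ`-equivariance along `β_{N,N'}^bs` FROM the naturality of the Galois surjections (Def. 4.1 (ii), p. 313; Rmk. 4.3.2, p. 318 / PDF pp. 87, 92)

Mochizuki, *The étale theta function …*, Publ. RIMS **45** (2009)
[cite: MochizukiEtTh2009, Def 4.1 (ii) p.313 (PDF p.87); Rmk 4.3.2 p.318 (PDF p.92)].  Seat abc-iut-L2-t4 (§5 owner), W3-L2-01 /
MERGE-PLAN row 14, PROOF-ONLY companion of `FrobenioidThetaTowerOfBiKummerFamily.lean` (p420398).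

The assembled tower `ThetaFrobenioidTower.ofBiKummerFamily` takes as INPUT the outer equivariance `ρ_comm_β` of the Galois actions
`ρ_N = ((s^⊓_N)^bs)-conjugate of Π^tp_X ↠ Aut_D(A_N^bs)` along the transitions `β_{N,N'}^bs` ("natural surjective OUTER homomorphism",
Def. 4.1 (ii)).  This file DERIVES it (`rhoFamily_comm_of_natural`) from (a) the Remark 4.3.2 square `s^⊓_{N'} ≫ β = α ≫ s^⊓_N`
(p.318 (PDF p.92)) read on bases and (b) the NATURALITY LAW of the setting's Galois surjections in the OUTER field shape `hS` of
abc-iut-w5-d013's `Discharge/Sec4GaloisSurjNatural.lean` (p419069; the planned field `galoisSurj_natural` of abc-iut-L2-t3's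
`BiKummerSetting`, a THEOREM at the genuine temperoid `B^temp(Π^tp_X)`), applied to `α^bs : A_{N'}^bs → A_N^bs` between the Galois
`N'`- and `N`-domains.  So the tower's `ρ_comm_β` input is discharged by `hS` + the printed squares (`rho_comm_β_of_natural`).
HONEST FRAMING: kernel-checked implication; `hS` itself is abc-iut-L2-t3's interface law (binder); no side taken downstream.
-/

noncomputable section

namespace Literature.AnabelianGeometry.EtaleTheta

open CategoryTheory Opposite Literature.AlgebraicGeometry.Frobenioids

universe u₀ v₀ u v w

namespace ThetaFrobenioidTower

variable {K : Type u₀} [Field K] {X : SemiGraphs.TemperedArithmeticGroup.{u₀} K} {D₀ : Type u₀} [Category.{v₀} D₀]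
  {V : FrdIMonoidStub.{w}} {T₀ : RealifiedDivisorMonoids (D₀ := D₀) V} {D : Type u} [Category.{v} D]
  {VD : FrdICatStub.{u, v, w} D} {S : BiKummerSetting X T₀ D VD}
  {pullFrac : ∀ {A A' : S.C} (_ : A' ⟶ A), S.biratUnits A → S.biratUnits A'}
  {lv : ℕ+} {E : Set ℕ+} {𝒯 : ThetaEnvTower.{max v w} E} {θ : S.biratUnits S.Aodot} {Bl : S.C}
  {Pl : S.FractionPair θ Bl} {Rl : S.NthRoot θ Pl lv pullFrac}
  (R : ∀ N : ℕ+, S.NthRoot Rl.root Rl.pair N pullFrac) (ιX : 𝒯.PiX ≃ₜ* X.Pi)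
  (hS : ∀ ⦃A B : D⦄ (hA : S.IsGaloisObj A) (hB : S.IsGaloisObj B) (b : B ⟶ A),
    ∃ c : X.Pi, ∀ g : X.Pi, (S.galoisSurj B hB g).hom ≫ b = b ≫ (S.galoisSurj A hA (c * g * c⁻¹)).hom)

include hS in
/-- **Outer equivariance of `ρ_{N'}`, `ρ_N` along `β^bs`** from the naturality law `hS` of the Galois surjections (Def. 4.1 (ii), outer
form) applied to `α^bs : A_{N'}^bs → A_N^bs`, and the Rmk. 4.3.2 square `s^⊓_{N'} ≫ β = α ≫ s^⊓_N` (p.318 (PDF p.92)): there is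
`x ∈ Π^tp_X` with `ρ_{N'}(g) ≫ β^bs = β^bs ≫ ρ_N(x g x⁻¹)` for all `g`.  [cite: MochizukiEtTh2009, Def 4.1 (ii) p.313 (PDF p.87); Rmk 4.3.2 p.318 (PDF p.92)] -/
theorem rhoFamily_comm_of_natural {N N' : ℕ+} (α : (R N').AN ⟶ (R N).AN) (β : (R N').BN ⟶ (R N).BN)
    (hsq : (R N').pair.num ≫ β = α ≫ (R N).pair.num) :
    ∃ x : 𝒯.PiX, ∀ g : 𝒯.PiX,
      (rhoFamily R ιX N' g).hom ≫ ModelFrobenioid.baseMap β =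
        ModelFrobenioid.baseMap β ≫ (rhoFamily R ιX N (x * g * x⁻¹)).hom := by
  obtain ⟨c, hc⟩ := hS (R N).αData.isGalois (R N').αData.isGalois (ModelFrobenioid.baseMap α)
  refine ⟨ιX.toMulEquiv.symm c, fun g => ?_⟩
  -- the base square `(s^⊓_{N'})^bs ≫ β^bs = α^bs ≫ (s^⊓_N)^bs`
  have hb : (BiKummerSetting.NthRoot.baseIso S (R N')).hom ≫ ModelFrobenioid.baseMap β =
      ModelFrobenioid.baseMap α ≫ (BiKummerSetting.NthRoot.baseIso S (R N)).hom := by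
    rw [BiKummerSetting.NthRoot.baseIso_hom, BiKummerSetting.NthRoot.baseIso_hom, ← ModelFrobenioid.baseMap_comp, hsq,
      ModelFrobenioid.baseMap_comp]
  have hb' : ModelFrobenioid.baseMap β =
      (BiKummerSetting.NthRoot.baseIso S (R N')).inv ≫ ModelFrobenioid.baseMap α ≫
        (BiKummerSetting.NthRoot.baseIso S (R N)).hom := by
    rw [← hb, Iso.inv_hom_id_assoc]
  have hι : ιX (ιX.toMulEquiv.symm c * g * (ιX.toMulEquiv.symm c)⁻¹) = c * ιX g * c⁻¹ := by
    have h1 : ιX (ιX.toMulEquiv.symm c) = c := ιX.toMulEquiv.apply_symm_apply c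
    rw [map_mul, map_mul, map_inv, h1]
  rw [rhoFamily_apply, rhoFamily_apply, Iso.conjAut_hom, Iso.conjAut_hom, Iso.conj_apply, Iso.conj_apply]
  simp only [Category.assoc]
  rw [hι, hb']
  simp only [Category.assoc, Iso.hom_inv_id_assoc]
  rw [← Category.assoc (S.galoisSurj (R N').AN.base (R N').αData.isGalois (ιX g)).hom, hc (ιX g), Category.assoc]

include hS in
/-- **The tower's input `ρ_comm_β` from the naturality law**: for a family of transitions `(α_{N,N'}, β_{N,N'})` satisfying the first
Rmk. 4.3.2 square at every `N ∣ N'`, the outer equivariance required by `ThetaFrobenioidTower.ofBiKummerFamily` holds.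
[cite: MochizukiEtTh2009, Def 4.1 (ii) p.313 (PDF p.87); Rmk 4.3.2 p.318 (PDF p.92)] -/
theorem rho_comm_β_of_natural (α : ∀ {N N' : ℕ+}, (N : ℕ) ∣ N' → ((R N').AN ⟶ (R N).AN))
    (β : ∀ {N N' : ℕ+}, (N : ℕ) ∣ N' → ((R N').BN ⟶ (R N).BN))
    (comm_sCap : ∀ {N N' : ℕ+} (hd : (N : ℕ) ∣ N'), (R N').pair.num ≫ β hd = α hd ≫ (R N).pair.num)
    {N N' : ℕ+} (hd : (N : ℕ) ∣ N') :
    ∃ x : 𝒯.PiX, ∀ g : 𝒯.PiX,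
      (rhoFamily R ιX N' g).hom ≫ ModelFrobenioid.baseMap (β hd) =
        ModelFrobenioid.baseMap (β hd) ≫ (rhoFamily R ιX N (x * g * x⁻¹)).hom :=
  rhoFamily_comm_of_natural R ιX hS (α hd) (β hd) (comm_sCap hd)

end ThetaFrobenioidTower

end Literature.AnabelianGeometry.EtaleTheta

end
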